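import Mathlib
import Literature.Analysis.FluidPDE.ClassicalSolutionRescale
import Summits.NavierStokesRegularity.NavierStokesRegularity.Theorems.LandauTailLandauTailBlowupLandau
import Summits.NavierStokesRegularity.NavierStokesRegularity.Theorems.LandauTailLandauTailBlowupTypeIIPrep
import Summits.NavierStokesRegularity.NavierStokesRegularity.Theorems.LandauTailLandauTailBlowupVitali
import Summits.NavierStokesRegularity.NavierStokesRegularity.Theorems.LandauTailLandauTailBlowupFluxIntegral
import Summits.NavierStokesRegularity.NavierStokesRegularity.Theorems.LandauTailLandauTailBlowupDivFreeTest
import Summits.NavierStokesRegularity.NavierStokesRegularity.Theorems.LandauTailLandauTailBlowupLandauFlux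

/-!
# Landau-tailed singularities are Type II in every scaled Lebesgue norm (the momentum-flux theorem)

Helper file for the crux item `stmt-NavierStokesRegularity-1944` (`LandauTail.LandauTailBlowup`, line
`registered`, cut `X ⇐ LandauTailLocal ∧ LandauTailTransfer`). It assembles the registered support stubs of
cycle c5 into the two theorems the lead held:

* `landauTail_scaledNorm_tendsto_top` — **main theorem.** Let `(u, p)` be a classical solution of the
  unforced unit-viscosity Navier–Stokes system on `ℝ³ × (−1, 0)` whose parabolic rescaling converges off
  the origin to a nonzero steady `(−1)`-homogeneous profile `(U, P)` smooth off `0` (= a Landau solution):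
  `√(−t) u(t, √(−t) y) → U y` for every `y ≠ 0` — i.e. any witness of the body of `LandauTailLocal` (item
  stmt-NavierStokesRegularity-1946), Tsai bounds not needed. Then for EVERY real `q > 2` the CKN-scaled
  space–time Lebesgue norms over the parabolic cylinders `Q_r(0,0) = (−r², 0) × B_r` diverge:
  `r^{q−5} ∫∫_{Q_r} |u|^q → ∞` as `r → 0⁺`. For `q ≥ 3` this is Fatou's lemma through the frozen
  `1/|x|` annulus (`landauTail_scaledNorm_tendsto_top_of_three_le`, the registered stub M′; `q = 3` is
  Seregin's `C(r) → ∞`). For `2 < q < 3` the Landau annulus contributes `O(1)` and the divergence is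
  forced on the CORE: were the scaled norms bounded along `r_n → 0⁺`, the Navier–Stokes rescalings
  `u_{r_n}(τ, y) = r_n u(r_n² τ, r_n y)` (classical solutions on `(−1,0)`, pointwise convergent to the
  STEADY Landau flow `U` off `y = 0`) would converge in `L²(Q₁)` (Vitali, stub S1), so `U` would satisfy
  the pressure-free very weak Navier–Stokes identity for all tests supported in `Q₁` (stub S2), hence the
  steady very weak identity `∫ ⟪U,(U·∇)φ⟫ + ⟪U,Δφ⟫ = 0` for every solenoidal `φ ∈ C_c^∞(B₁)`; but by the
  Landau flux identity (stub S3) this integral is `−⟪φ(0), B⟫` with the momentum flux `B` of `U` through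
  the unit shell, and for Landau's solution `⟪a, B⟫ = β(A) = 2π[(8A/3)(3A²+1)/(A²−1) − 4A² log((A+1)/(A−1))]
  > 0` (stubs S8, S5, S6; Šverák's normal form `U = landauAxisField a A`), so the solenoidal test field with
  `φ(0) = a` (stub S7) gives the contradiction. This is the card's "3-line flux argument" (a forceless core
  feeding a Landau far field must emit momentum at the constant rate `b(U)`) as a theorem about every
  witness: the core must concentrate scale-critical `L^q` mass for every `q > 2`.
* `landauTail_not_enveloped` — **no enveloped Landau tail.** Such a solution never satisfies the spatial
  Type-I envelope `|x| |u(t,x)| ≤ C` on `Q₁`, for any `C` (unconditionally; hitherto only modulo the open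
  item stmt-NavierStokesRegularity-1947 `EnvelopeRegularity`): the envelope is scale invariant and bounds
  `r^{q−5}∫∫_{Q_r}|u|^q` by `C^q ∫_{Q₁} |y|^{−q} < ∞` for `q < 3`.

References: L. D. Landau, Dokl. Akad. Nauk SSSR 43 (1944); G. K. Batchelor, *An Introduction to Fluid
Dynamics* (1967), §4.6; P. G. Lemarié-Rieusset, *The Navier–Stokes problem in the 21st century* (2016),
(10.48); V. Šverák, arXiv:math/0604550, §2; D. Chae, Math. Ann. 338 (2007), proof of Thm 1.5 (blow-up
rescaling and very weak limit); L. Caffarelli, R. Kohn, L. Nirenberg, CPAM 35 (1982) (scaled quantities);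
G. Seregin, V. Šverák, CPDE 34 (2009) (Type II in the scaled-energy sense).
-/
noncomputable section

open Filter Set Topology MeasureTheory Metric Function
open scoped ENNReal NNReal InnerProductSpace RealInnerProductSpace Laplacian ContDiff
open Literature.Analysis.FluidPDE

-- the summit-side namespace repeats a component by design (D-0017)
set_option linter.dupNamespace false

namespace Summit.NavierStokesRegularity.NavierStokesRegularity.Theorems
/-! ### The main theorem -/

/-- **Landau-tailed first singularities are Type II in every scaled Lebesgue norm** (registered support
stub of crux stmt-NavierStokesRegularity-1944, the lead's main theorem of cycle c5). For a classical
unit-viscosity solution `(u, p)` of the unforced Navier–Stokes system on `ℝ³ × (−1, 0)` with a parabolic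
tail `√(−t) u(t, √(−t) y) → U y` (`y ≠ 0`) to a nonzero steady `(−1)`-homogeneous profile `(U, P)` smooth
off the origin (a Landau solution, Šverák 2011), and every real `q > 2`:
`r^{q−5} ∫∫_{Q_r(0,0)} |u|^q → ∞` as `r → 0⁺`. Case `q ≥ 3`: Fatou
(`landauTail_scaledNorm_tendsto_top_of_three_le`). Case `2 < q < 3` (the core): a bounded sequence of
scaled norms along `r_n → 0⁺` makes the Navier–Stokes rescalings `u_{r_n}` converge in `L²(Q₁)` (a.e.
convergence to the steady Landau flow `U` off the axis of time, `landauTail_nsRescale_tendsto_profile`, +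
the `L^q(Q₁)` bound, Vitali `landauTail_tendsto_eLpNorm_two_of_eLpNorm_le`), so by
`landauTail_veryWeak_of_tendsto_L2` the steady field `U` satisfies the very weak Navier–Stokes identity
for the test fields `θ(t) φ(x)` supported in `Q₁`, i.e. `(∫θ) ∫(⟪U,(U·∇)φ⟫ + ⟪U,Δφ⟫) = 0`
(`landauTail_veryWeak_smul_eq`); with Šverák's normal form `U = landauAxisField a A`
(`landauTail_exists_axis_of_profile`), the solenoidal `φ` with `φ(0) = a`
(`landauTail_exists_divFree_test`) and the flux identity `∫(⟪U,(U·∇)φ⟫ + ⟪U,Δφ⟫) = −⟪a, B⟫ = −β(A) < 0`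
(`landauTail_flux_identity`, `landauTail_landau_flux_eq`, `landauTail_landau_flux_integral`,
`landauTail_landau_flux_pos`) this is absurd. (Landau 1944; Lemarié-Rieusset 2016 (10.48); Chae 2007,
proof of Thm 1.5; CKN 1982.) -/
theorem landauTail_scaledNorm_tendsto_top : ∀ (u : ℝ → EuclideanSpace ℝ (Fin 3) → EuclideanSpace ℝ (Fin 3)) (p : ℝ → EuclideanSpace ℝ (Fin 3) → ℝ) (U : EuclideanSpace ℝ (Fin 3) → EuclideanSpace ℝ (Fin 3)) (P : EuclideanSpace ℝ (Fin 3) → ℝ), (ContDiffOn ℝ (⊤ : ℕ∞) U {0}ᶜ ∧ ContDiffOn ℝ (⊤ : ℕ∞) P {0}ᶜ ∧ (∀ x : EuclideanSpace ℝ (Fin 3), x ≠ 0 → Literature.Analysis.FluidPDE.convect U U x + gradient P x = (1 : ℝ) • Laplacian.laplacian U x) ∧ (∀ x : EuclideanSpace ℝ (Fin 3), x ≠ 0 → Literature.Analysis.FluidPDE.VectorCalculus.divergence U x = 0) ∧ (∀ c : ℝ, 0 < c → ∀ x : EuclideanSpace ℝ (Fin 3), U (c • x) = c⁻¹ • U x)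 ∧ (∃ x : EuclideanSpace ℝ (Fin 3), U x ≠ 0)) → Literature.Analysis.FluidPDE.IsClassicalNSSolutionOn (Set.Ioo (-1) 0) 1 0 u p → (∀ y : EuclideanSpace ℝ (Fin 3), y ≠ 0 → Filter.Tendsto (fun t : ℝ => Real.sqrt (0 - t) • u t (Real.sqrt (0 - t) • y)) (nhdsWithin 0 (Set.Iio 0)) (nhds (U y))) → ∀ q : ℝ, 2 < q → Filter.Tendsto (fun r : ℝ => ENNReal.ofReal (r ^ (q - 5)) * ∫⁻ z in Literature.Analysis.FluidPDE.parabolicCylinder r ((0 : ℝ), (0 : EuclideanSpace ℝ (Fin 3))), ‖u z.1 z.2‖ₑ ^ q) (nhdsWithin 0 (Set.Ioi 0)) (nhds ⊤) := by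
  intro u p U P hprof hcl htail q hq
  obtain ⟨hUs, hPs, hNS, hdiv, hhom, hne⟩ := hprof
  have hUc : ContinuousOn U {0}ᶜ := hUs.continuousOn
  have huc : ContinuousOn (uncurry u) (Ioo (-1 : ℝ) 0 ×ˢ univ) := hcl.smooth_velocity.continuousOn
  rcases le_or_gt 3 q with hq3 | hq3
  · exact landauTail_scaledNorm_tendsto_top_of_three_le u U huc hUc hhom hne htail q hq3
  have hq0 : 0 < q := by linarith
  set Q₁ : Set (ℝ × EuclideanSpace ℝ (Fin 3)) :=
    parabolicCylinder 1 ((0 : ℝ), (0 : EuclideanSpace ℝ (Fin 3))) with hQ₁_def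
  -- Step 1: the scaled norms are the norms of the rescalings over `Q₁`
  have hcongr : (fun r : ℝ => ∫⁻ z in Q₁, ‖nsRescale r u z.1 z.2‖ₑ ^ q) =ᶠ[𝓝[>] 0]
      fun r => ENNReal.ofReal (r ^ (q - 5)) *
        ∫⁻ z in parabolicCylinder r ((0 : ℝ), (0 : EuclideanSpace ℝ (Fin 3))), ‖u z.1 z.2‖ₑ ^ q := by
    filter_upwards [self_mem_nhdsWithin] with r hr
    exact (landauTail_scaled_lintegral_eq_nsRescale u q hq0 r hr).symm
  refine Tendsto.congr' hcongr ?_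
  -- Step 2: a frequently undershot level gives a sequence `r_n → 0⁺` in `(0,1)` with bounded norms
  rw [ENNReal.tendsto_nhds_top_iff_nnreal]
  intro M
  by_contra hcon
  have hfreq : ∃ᶠ r in 𝓝[>] (0 : ℝ), (∫⁻ z in Q₁, ‖nsRescale r u z.1 z.2‖ₑ ^ q) ≤ M := by
    rw [not_eventually] at hcon
    exact hcon.mono fun r hr => not_lt.1 hr
  obtain ⟨rs, hrs, hrs'⟩ := exists_seq_forall_of_frequently
    (hfreq.and_eventually (Ioo_mem_nhdsGT zero_lt_one : Set.Ioo (0 : ℝ) 1 ∈ 𝓝[>] (0 : ℝ)))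
  have hQ₁ : Q₁ = Ioo (-1 : ℝ) 0 ×ˢ ball (0 : EuclideanSpace ℝ (Fin 3)) 1 := by
    ext z
    simp only [hQ₁_def, mem_parabolicCylinder, mem_prod, mem_Ioo, mem_ball]
    norm_num
  have hSm : MeasurableSet (Ioo (-1 : ℝ) 0 ×ˢ ball (0 : EuclideanSpace ℝ (Fin 3)) 1) :=
    measurableSet_Ioo.prod measurableSet_ball
  -- Step 3: the rescalings are classical solutions on `(-1, 0)`
  set w : ℕ → ℝ → EuclideanSpace ℝ (Fin 3) → EuclideanSpace ℝ (Fin 3) := fun n => nsRescale (rs n) u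
    with hw_def
  have hwcl : ∀ n, IsClassicalNSSolutionOn (Ioo (-1) 0) 1 0 (w n) (nsRescalePressure (rs n) p) := by
    intro n
    obtain ⟨hr0, hr1⟩ := (hrs' n).2
    have key := IsClassicalNSSolutionOn.nsRescale_holds hcl hr0
    rw [nsRescaleForce_zero] at key
    refine key.mono (fun t ht => ?_) (uniqueDiffOn_Ioo (-1) 0)
    simp only [mem_preimage, mem_Ioo] at ht ⊢
    have hr2 : (rs n) ^ 2 ≤ 1 := pow_le_one₀ hr0.le hr1.le
    refine ⟨?_, mul_neg_of_pos_of_neg (pow_pos hr0 2) ht.2⟩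
    nlinarith [mul_nonneg (sub_nonneg.2 hr2) (neg_nonneg.2 ht.2.le)]
  have hwc : ∀ n, ContinuousOn (uncurry (w n)) (Ioo (-1 : ℝ) 0 ×ˢ univ) := fun n =>
    (hwcl n).smooth_velocity.continuousOn
  -- Step 4: the test field `θ(t) φ(x)` with `φ(0) = a`, `a` the Landau axis of `U`
  obtain ⟨a, ha, A, hA, hUeq⟩ := landauTail_exists_axis_of_profile one_pos hUs hPs hNS hdiv hhom hne
  obtain ⟨φ, hφs, hφc, hφsupp, hφdiv, hφ0⟩ := landauTail_exists_divFree_test a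
  let θb : ContDiffBump (-1 / 2 : ℝ) := ⟨1 / 8, 1 / 4, by norm_num, by norm_num⟩
  have hθs : ContDiff ℝ ∞ θb := θb.contDiff
  have hθsupp : tsupport θb ⊆ Ioo (-1 : ℝ) 0 := by
    rw [θb.tsupport_eq]
    intro t ht
    rw [mem_closedBall, Real.dist_eq, abs_le] at ht
    constructor <;> linarith [ht.1, ht.2]
  have hθK : IsCompact (tsupport θb) := by
    rw [θb.tsupport_eq]
    exact isCompact_closedBall _ _
  have hθint : 0 < ∫ t, θb t := θb.integral_pos
  set ψ : ℝ → EuclideanSpace ℝ (Fin 3) → EuclideanSpace ℝ (Fin 3) := fun t x => θb t • φ x with hψ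
  have hψtest : IsSpaceTimeTestOn (parabolicCylinderOpens 1 ((0 : ℝ), (0 : EuclideanSpace ℝ (Fin 3)))) ψ :=
    landauTail_isSpaceTimeTestOn_smul hθs hθK hθsupp hφs hφc hφsupp hψ
  have hψdiv : ∀ t, VectorCalculus.IsDivFree (ψ t) := by
    intro t x
    show VectorCalculus.divergence (fun x => θb t • φ x) x = 0
    rw [divergence_const_smul_apply (hφs.differentiable (by simp) x), hφdiv x, mul_zero]
  have hψslab : IsSpaceTimeTestOn (slab (EuclideanSpace ℝ (Fin 3)) (Ioo (-1) 0) isOpen_Ioo) ψ :=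
    hψtest.mono fun z hz => by
      have hz' : z ∈ parabolicCylinder 1 ((0 : ℝ), (0 : EuclideanSpace ℝ (Fin 3))) := hz
      rw [mem_parabolicCylinder] at hz'
      refine mem_slab.2 ⟨?_, hz'.1.2⟩
      have h1 := hz'.1.1
      norm_num at h1
      exact h1
  have hid : ∀ n, ∫ t in Ioo (-1 : ℝ) 0, ∫ x, (⟪w n t x, timeDeriv ψ t x⟫ +
      ⟪w n t x, convect (w n t) (ψ t) x⟫ + 1 * ⟪w n t x, Δ (ψ t) x⟫) = 0 := fun n =>
    (hwcl n).integral_veryWeak_eq_zero hψslab hψdiv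
  -- Step 5: Vitali — `L²(Q₁)` convergence of the rescalings to the steady profile
  set μ : Measure (ℝ × EuclideanSpace ℝ (Fin 3)) :=
    volume.restrict (Ioo (-1 : ℝ) 0 ×ˢ ball (0 : EuclideanSpace ℝ (Fin 3)) 1) with hμ
  haveI : IsFiniteMeasure μ := by
    refine ⟨?_⟩
    rw [hμ, Measure.restrict_apply_univ, Measure.volume_eq_prod, Measure.prod_prod, Real.volume_Ioo]
    exact ENNReal.mul_lt_top ENNReal.ofReal_lt_top measure_ball_lt_top
  set f : ℕ → ℝ × EuclideanSpace ℝ (Fin 3) → EuclideanSpace ℝ (Fin 3) := fun n z => w n z.1 z.2 with hf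
  set g : ℝ × EuclideanSpace ℝ (Fin 3) → EuclideanSpace ℝ (Fin 3) := fun z => U z.2 with hg
  have hfm : ∀ n, AEStronglyMeasurable (f n) μ := by
    intro n
    obtain ⟨hr0, hr1⟩ := (hrs' n).2
    have hΦ : Continuous fun z : ℝ × EuclideanSpace ℝ (Fin 3) => ((rs n) ^ 2 * z.1, (rs n) • z.2) := by
      fun_prop
    have hmaps : MapsTo (fun z : ℝ × EuclideanSpace ℝ (Fin 3) => ((rs n) ^ 2 * z.1, (rs n) • z.2))
        (Ioo (-1 : ℝ) 0 ×ˢ ball (0 : EuclideanSpace ℝ (Fin 3)) 1) (Ioo (-1 : ℝ) 0 ×ˢ univ) := by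
      intro z hz
      obtain ⟨⟨hz1, hz2⟩, -⟩ := hz
      have hr2 : (rs n) ^ 2 ≤ 1 := pow_le_one₀ hr0.le hr1.le
      refine ⟨⟨?_, mul_neg_of_pos_of_neg (pow_pos hr0 2) hz2⟩, mem_univ _⟩
      show (-1 : ℝ) < (rs n) ^ 2 * z.1
      nlinarith [mul_nonneg (sub_nonneg.2 hr2) (neg_nonneg.2 hz2.le)]
    have hcont : ContinuousOn (f n) (Ioo (-1 : ℝ) 0 ×ˢ ball (0 : EuclideanSpace ℝ (Fin 3)) 1) :=
      ((huc.comp hΦ.continuousOn hmaps).const_smul (rs n)).congr fun z _ => rfl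
    exact hcont.aestronglyMeasurable hSm
  have hbdd : ∃ C : ℝ≥0, ∀ n, eLpNorm (f n) (ENNReal.ofReal q) μ ≤ C := by
    refine ⟨M ^ (1 / q), fun n => ?_⟩
    have hq' : ENNReal.ofReal q ≠ 0 := (ENNReal.ofReal_pos.2 hq0).ne'
    rw [eLpNorm_eq_lintegral_rpow_enorm_toReal hq' ENNReal.ofReal_ne_top, ENNReal.toReal_ofReal hq0.le]
    have h1 : ∫⁻ z, ‖f n z‖ₑ ^ q ∂μ ≤ M := by
      have h := (hrs' n).1
      rwa [hQ₁] at h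
    calc (∫⁻ z, ‖f n z‖ₑ ^ q ∂μ) ^ (1 / q) ≤ (M : ℝ≥0∞) ^ (1 / q) :=
          ENNReal.rpow_le_rpow h1 (by positivity)
      _ = ((M ^ (1 / q) : ℝ≥0) : ℝ≥0∞) := (ENNReal.coe_rpow_of_nonneg _ (by positivity)).symm
  have hae0 : ∀ᵐ z ∂(volume : Measure (ℝ × EuclideanSpace ℝ (Fin 3))), z.2 ≠ 0 := by
    have e : {z : ℝ × EuclideanSpace ℝ (Fin 3) | z.2 = 0} = univ ×ˢ {0} := by
      ext z
      simp
    rw [ae_iff]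
    simp only [not_not]
    rw [e, Measure.volume_eq_prod, Measure.prod_prod, measure_singleton, mul_zero]
  have hfg : ∀ᵐ z ∂μ, Tendsto (fun n => f n z) atTop (𝓝 (g z)) := by
    rw [hμ, ae_restrict_iff' hSm]
    filter_upwards [hae0] with z hz hzQ
    exact (landauTail_nsRescale_tendsto_profile u U hhom htail z.1 hzQ.1.2 z.2 hz).comp hrs
  have hq2 : (2 : ℝ≥0∞) < ENNReal.ofReal q := by
    rw [show (2 : ℝ≥0∞) = ENNReal.ofReal 2 by norm_num]
    exact (ENNReal.ofReal_lt_ofReal_iff hq0).2 hq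
  have hconv := landauTail_tendsto_eLpNorm_two_of_eLpNorm_le μ f g (ENNReal.ofReal q) hq2
    ENNReal.ofReal_ne_top hfm hbdd hfg
  -- Step 6: the steady profile satisfies the very weak identity on `Q₁`, hence `J = 0`
  have hUm : AEStronglyMeasurable U volume := (landauTail_profile_measurable hUc).aestronglyMeasurable
  have hU2 := landauTail_eLpNorm_profile_two_lt_top hUc hhom
  have hlimit := landauTail_veryWeak_of_tendsto_L2 w U ψ hwc hψtest hψdiv hid hUm hU2 hconv
  rw [landauTail_veryWeak_smul_eq hUc hhom hθs hθsupp hφs hφc hφsupp hψ] at hlimit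
  have hJ : ∫ x, (⟪U x, convect U φ x⟫ + ⟪U x, Δ φ x⟫) = 0 :=
    (mul_eq_zero.1 hlimit).resolve_left hθint.ne'
  -- Step 7: the flux of the Landau solution is not zero
  obtain ⟨hV, hPV, hNSV, hdivV, hhomV, -⟩ := landauTail_landauAxisField_profile ha hA
  have hflux := landauTail_flux_identity (landauAxisField a A) (landauAxisPressure a A) φ hV hPV hNSV
    hdivV hhomV (fun c hc x => landauAxisPressure_smul a A hc x) hφs hφc hφdiv
  rw [hφ0, landauTail_landau_flux_eq a A ha hA, landauTail_landau_flux_integral A hA] at hflux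
  have hpos := landauTail_landau_flux_pos A hA
  have hJV : ∫ x, (⟪U x, convect U φ x⟫ + ⟪U x, Δ φ x⟫) =
      ∫ x, (⟪landauAxisField a A x, convect (landauAxisField a A) φ x⟫ + ⟪landauAxisField a A x, Δ φ x⟫) := by
    refine integral_congr_ae ?_
    filter_upwards [compl_mem_ae_iff.2 (measure_singleton (0 : EuclideanSpace ℝ (Fin 3)))] with x hx
    simp only [convect, hUeq x hx, one_smul]
  rw [hJV, hflux] at hJ
  have hπ := Real.pi_pos
  nlinarith

/-- **No enveloped Landau tail** (registered support stub of crux stmt-NavierStokesRegularity-1944): a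
Landau-tailed local classical solution as in `landauTail_scaledNorm_tendsto_top` never obeys the spatial
Type-I envelope `|x| |u(t,x)| ≤ C` on `Q₁ = (−1,0) × B₁`, for any `C` — unconditionally (the route so far
killed the enveloped architecture only modulo the open item stmt-NavierStokesRegularity-1947
`EnvelopeRegularity`). Proof: the envelope is scale invariant and bounds the scaled norms
`r^{q−5}∫∫_{Q_r}|u|^q`, `q = 5/2`, by `∫∫_{Q₁}(C/|y|)^{5/2} < ∞` (`landauTail_scaled_le_of_envelope`),
contradicting their divergence. [folklore] -/
theorem landauTail_not_enveloped : ∀ (u : ℝ → EuclideanSpace ℝ (Fin 3) → EuclideanSpace ℝ (Fin 3)) (p : ℝ → EuclideanSpace ℝ (Fin 3) → ℝ) (U : EuclideanSpace ℝ (Fin 3) → EuclideanSpace ℝ (Fin 3)) (P : EuclideanSpace ℝ (Fin 3) → ℝ), (ContDiffOn ℝ (⊤ : ℕ∞) U {0}ᶜ ∧ ContDiffOn ℝ (⊤ : ℕ∞) P {0}ᶜ ∧ (∀ x : EuclideanSpace ℝ (Fin 3), x ≠ 0 → Literature.Analysis.FluidPDE.convect U U x + gradient P x = (1 : ℝ)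 • Laplacian.laplacian U x) ∧ (∀ x : EuclideanSpace ℝ (Fin 3), x ≠ 0 → Literature.Analysis.FluidPDE.VectorCalculus.divergence U x = 0) ∧ (∀ c : ℝ, 0 < c → ∀ x : EuclideanSpace ℝ (Fin 3), U (c • x) = c⁻¹ • U x) ∧ (∃ x : EuclideanSpace ℝ (Fin 3), U x ≠ 0)) → Literature.Analysis.FluidPDE.IsClassicalNSSolutionOn (Set.Ioo (-1) 0) 1 0 u p → (∀ y : EuclideanSpace ℝ (Fin 3), y ≠ 0 → Filter.Tendsto (fun t : ℝ => Real.sqrt (0 - t) • u t (Real.sqrt (0 - t) • y)) (nhdsWithin 0 (Set.Iio 0)) (nhds (U y))) → ¬ ∃ C : ℝ, ∀ t ∈ Set.Ioo (-1 : ℝ) 0, ∀ x ∈ Metric.ball (0 : EuclideanSpace ℝ (Fin 3)) 1, ‖x‖ * ‖u t x‖ ≤ C := by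
  intro u p U P hprof hcl htail hC
  obtain ⟨C, hC⟩ := hC
  have hmain := landauTail_scaledNorm_tendsto_top u p U P hprof hcl htail (5 / 2) (by norm_num)
  obtain ⟨K, hK, hbound⟩ := landauTail_scaled_le_of_envelope u C (5 / 2) hC (by norm_num) (by norm_num)
  obtain ⟨r, hr1, hr2⟩ := ((hmain.eventually_const_lt hK).and
    (Ioo_mem_nhdsGT zero_lt_one : Set.Ioo (0 : ℝ) 1 ∈ 𝓝[>] (0 : ℝ))).exists
  exact (lt_irrefl K) (hr1.trans_le (hbound r hr2))

end Summit.NavierStokesRegularity.NavierStokesRegularity.Theorems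

end
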